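import Summits.ResolutionOfSingularities.ResolutionOfSingularities.Theorems.PAlterationPialtRadicialCover
import Summits.ResolutionOfSingularities.ResolutionOfSingularities.Theorems.PAlterationPicoverFunctionFieldNormalizationIn
import Literature.AlgebraicGeometry.Resolution.NormalizationInSeparable
import Literature.AlgebraicGeometry.Resolution.NormalizationInNormal
import HarnessLib

/-!
# `Pialt` (crux stmt-ResolutionOfSingularities-0555): purely inseparable normalisations

Companion to `PAlterationPialtRadicialCover.lean` (landed `--supports stmt-ResolutionOfSingularities-0555`;
does not close the item). The sufficient condition for the crux `Pialt` that a LINE would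
actually establish, in function-field terms: for a NORMAL integral variety `X` over a field of
characteristic `p` it suffices to exhibit ONE finite purely inseparable extension `L ⊇ K(X)` such
that the normalisation `X^L = normalizationIn X L` of `X` in `L` (Liu 2002, Def. 4.1.24) admits a
resolution of singularities:

* `universallyInjective_normalizationInι_of_isPurelyInseparable` — for `X` normal and `L/K(X)`
  finite purely inseparable, `X^L → X` is universally injective (radicial): it is the relative
  normalisation of `Spec L → X`, whose function-field extension is `L/K(X)` up to the canonical
  identification, so the in-tree `universallyInjective_fromNormalization` (an element of the
  integral closure has a `p^n`-th power in the normal base) applies;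
* `pialtConclusion_of_hasResolution_normalizationIn` — hence (`X^L → X` is also finite by
  E. Noether and surjective) a resolution of `X^L` composes to a purely inseparable regular
  alteration of `X`;
* `pialt_of_forall_normal_exists_hasResolution_normalizationIn` — **`Pialt` follows if every
  normal integral variety over a field of characteristic `p` has a finite purely inseparable
  extension of its function field in which its normalisation is resolvable** (with
  `pialt_iff_forall_normal`).

Sources: Q. Liu, *Algebraic Geometry and Arithmetic Curves* (2002), Def. 4.1.24, Prop. 4.1.25,
4.1.27; M. Temkin, J. Algebra 373 (2013), §1.3, Rem. 1.3.5(i); Stacks Project, Tags 01S2–01S4,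
035Q, 0BXR.
-/

noncomputable section

set_option linter.dupNamespace false -- mandated namespace of this single-conjunct summit

namespace Summit.ResolutionOfSingularities.ResolutionOfSingularities.Theorems

open CategoryTheory AlgebraicGeometry TopologicalSpace
open Literature.AlgebraicGeometry.Resolution Literature.AlgebraicGeometry.Motives
open Literature.AlgebraicGeometry.Motives.RatFn
open Summit.ResolutionOfSingularities.ResolutionOfSingularities.Theorems.Picover.FunctionFieldNormalizationIn
open Summit.ResolutionOfSingularities.ResolutionOfSingularities.Theses.PAlteration (Pialt)

/-! ## The function field of `Spec L` over `K(X)` is `L` -/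

section SpecExtension

variable (X : Scheme.{0}) [IsIntegral X] (L : Type) [Field L] [Algebra X.functionField L]

/-- The germ map `L = Γ(Spec L, ⊤) → 𝒪_{Spec L, η} = K(Spec L)` is a bijective `K(X)`-algebra
homomorphism onto `FunctionFieldOver (fromSpecExtension X L)` (`K(Spec L)` as a `K(X)`-algebra
along `ξ_L : Spec L → X`): bijective by `bijective_ΓSpecIso_inv_germ`, and it intertwines
`K(X) → L` with `ξ_L^♯` (`functionFieldMap_fromSpecExtension_apply`). [folklore] -/
theorem exists_algEquiv_functionFieldOver_fromSpecExtension :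
    ∃ e : L ≃ₐ[X.functionField] FunctionFieldOver (fromSpecExtension X L),
      (e : L → FunctionFieldOver (fromSpecExtension X L)) =
        ((Scheme.ΓSpecIso (.of L)).inv ≫ (Spec (.of L)).presheaf.germ ⊤
          (genericPoint (Spec (.of L))) trivial).hom :=
  ⟨AlgEquiv.ofBijective
    { toRingHom := ((Scheme.ΓSpecIso (.of L)).inv ≫ (Spec (.of L)).presheaf.germ ⊤
          (genericPoint (Spec (.of L))) trivial).hom
      commutes' := fun a => (functionFieldMap_fromSpecExtension_apply (W := X) (L := L) a).symm }
    (bijective_ΓSpecIso_inv_germ L (genericPoint (Spec (.of L)))), rfl⟩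

/-- `K(Spec L)/K(X)` is finite when `L/K(X)` is. [folklore] -/
theorem finiteDimensional_functionFieldOver_fromSpecExtension
    [FiniteDimensional X.functionField L] :
    FiniteDimensional X.functionField (FunctionFieldOver (fromSpecExtension X L)) := by
  obtain ⟨e, -⟩ := exists_algEquiv_functionFieldOver_fromSpecExtension X L
  exact LinearEquiv.finiteDimensional e.toLinearEquiv

/-- `K(Spec L)/K(X)` is purely inseparable when `L/K(X)` is. [folklore] -/
theorem isPurelyInseparable_functionFieldOver_fromSpecExtension
    [IsPurelyInseparable X.functionField L] :
    IsPurelyInseparable X.functionField (FunctionFieldOver (fromSpecExtension X L)) := by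
  obtain ⟨e, -⟩ := exists_algEquiv_functionFieldOver_fromSpecExtension X L
  exact AlgEquiv.isPurelyInseparable e

end SpecExtension

/-! ## Radiciality of `X^L → X` for `L/K(X)` purely inseparable and `X` normal -/

/-- **The normalisation of a normal integral scheme in a finite purely inseparable extension of
its function field is universally injective over it** (generalising the degree-`p` case
`Picover.DegPOfPicover.universallyInjective_normalizationInι`): `X^L → X` is the relative
normalisation of `ξ_L : Spec L → X`, with `K(Spec L) = L` purely inseparable over `K(X)`, so
`universallyInjective_fromNormalization` (locally `Spec C → Spec A` with every `c ∈ C` having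
`c^{p^n} ∈ A`, as `A` is integrally closed in `K(X)`) applies. [folklore] -/
theorem universallyInjective_normalizationInι_of_isPurelyInseparable (X : Scheme.{0})
    [IsIntegral X] (L : Type) [Field L] [Algebra X.functionField L] (p : ℕ) [Fact p.Prime]
    [CharP X.functionField p] [IsPurelyInseparable X.functionField L]
    (hN : ∀ x : X, IsIntegrallyClosed (X.presheaf.stalk x)) :
    UniversallyInjective (normalizationInι X L) := by
  haveI := isPurelyInseparable_functionFieldOver_fromSpecExtension X L
  exact universallyInjective_fromNormalization (fromSpecExtension X L) hN p

/-! ## From a resolvable purely inseparable normalisation to the conclusion of `Pialt` -/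

/-- **A resolution of `X^L`, for `L/K(X)` finite purely inseparable and `X` normal of finite type
over a field of characteristic `p`, yields a purely inseparable regular alteration of `X`**:
`X^L → X` is finite (E. Noether, `isFinite_normalizationInι`), universally injective
(`universallyInjective_normalizationInι_of_isPurelyInseparable`) and surjective, `X^L` is
integral, and `pialtConclusion_of_exists_radicialCover_hasResolution` composes.
[cite: Temkin2013, Rem. 1.3.5(i); Liu2002, Prop. 4.1.27] -/
theorem pialtConclusion_of_hasResolution_normalizationIn {p : ℕ} (hp : p.Prime) (k : Type)
    [Field k] [CharP k p] (X : Scheme.{0}) [IsIntegral X] (f : X ⟶ Spec (.of k))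
    [LocallyOfFiniteType f] (hN : ∀ x : X, IsIntegrallyClosed (X.presheaf.stalk x))
    (L : Type) [Field L] [Algebra X.functionField L] [FiniteDimensional X.functionField L]
    [IsPurelyInseparable X.functionField L] (hres : Scheme.HasResolution (normalizationIn X L)) :
    ∃ (X' : Scheme.{0}) (g : X' ⟶ X), IsProper g ∧ IsIntegral X' ∧ Scheme.IsRegular X' ∧
      Function.Surjective g.base ∧ ∃ U : X.Opens, Dense (U : Set X) ∧ IsFinite (g ∣_ U) ∧
        UniversallyInjective (g ∣_ U) := by
  haveI : Fact p.Prime := ⟨hp⟩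
  haveI : CharP X.functionField p := by
    haveI : Nonempty (⊤ : X.Opens) := ⟨⟨genericPoint X, trivial⟩⟩
    exact (((X.germToFunctionField ⊤).hom.comp
      ((f.appTop).hom.comp (Scheme.ΓSpecIso (.of k)).inv.hom)).charP_iff_charP p).mp inferInstance
  have hfin : IsFinite (normalizationInι X L) := isFinite_normalizationInι X L f
  have hui : UniversallyInjective (normalizationInι X L) :=
    universallyInjective_normalizationInι_of_isPurelyInseparable X L p hN
  have hsurj : Function.Surjective (normalizationInι X L).base :=
    (surjective_normalizationInι X L).surj
  exact pialtConclusion_of_exists_radicialCover_hasResolution X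
    ⟨normalizationIn X L, normalizationInι X L, inferInstance, hfin, hui, hsurj, hres⟩

/-- **`Pialt` from resolvable purely inseparable normalisations**: if for every prime `p`, every
field `k` of characteristic `p` and every NORMAL integral separated `k`-scheme `X` of finite type
there is a finite purely inseparable extension `L ⊇ K(X)` whose normalisation `X^L` admits a
resolution of singularities, then `Pialt` holds (`pialt_iff_forall_normal` and
`pialtConclusion_of_hasResolution_normalizationIn`). This is the form in which Temkin's
inseparable local uniformization (Temkin 2013, Thm. 1.3.2: for each valuation `v` of `K(X)` some
finite purely inseparable `L_v` uniformizes `v`) would have to be globalised: ONE `L` for all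
valuations, and a resolution of `X^L`. [cite: Temkin2013, Conj. 1.3.1, Thm. 1.3.2] -/
theorem pialt_of_forall_normal_exists_hasResolution_normalizationIn
    (H : ∀ p : ℕ, p.Prime → ∀ (k : Type) [Field k] [CharP k p] (X : Scheme.{0})
      (f : X ⟶ Spec (.of k)), IsSeparated f → LocallyOfFiniteType f → QuasiCompact f →
        [IsIntegral X] → (∀ x : X, IsIntegrallyClosed (X.presheaf.stalk x)) →
          ∃ (L : Type) (_ : Field L) (_ : Algebra X.functionField L),
            FiniteDimensional X.functionField L ∧ IsPurelyInseparable X.functionField L ∧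
              Scheme.HasResolution (normalizationIn X L)) :
    Pialt := by
  rw [pialt_iff_forall_normal]
  intro p hp k _ _ X f hs hl hq hi hN
  haveI := hi; haveI := hl
  obtain ⟨L, _, _, hfd, hpi, hres⟩ := H p hp k X f hs hl hq hN
  haveI := hfd; haveI := hpi
  exact pialtConclusion_of_hasResolution_normalizationIn hp k X f hN L hres

end Summit.ResolutionOfSingularities.ResolutionOfSingularities.Theorems

end
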